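import Summits.Langlands.Langlands.Theorems.IrreducibilityBySelfDualityPairLBoundaryJSCornerUnitBoxProductForm
import Summits.Langlands.Langlands.Theorems.IrreducibilityBySelfDualityPairLBoundaryJSLocalSingleDatum
import Literature.NumberTheory.Automorphic.ArchRankinSelbergCornerTestVector
import Literature.NumberTheory.Automorphic.AutomorphicRepsGLCuspidalL2Step1ZFinite
import Literature.NumberTheory.Automorphic.CuspidalPairGardingFixed
import Literature.NumberTheory.Automorphic.SpreadIntertwiner
import Literature.NumberTheory.Automorphic.CornerTorusIwasawaData

/-!
# Crux `PairLBoundaryJS` (stmt-Langlands-13622), line `Sketch` — stub `stub_corner_local_single_datum` (W-CLSD):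
# ONE archimedean corner datum realised inside the translated corner box integral

Summit `Langlands`, sub-problem `Langlands`, helper file under `Theorems/` supporting the crux
`PairLBoundaryJS` (Arthur–Clozel (1989), Ch. 3, (2.2)), line `Sketch`, registered stub
`stub_corner_local_single_datum`.

This is the per-datum core of the local Rankin–Selberg theory of a cuspidal CORNER pair `(P, Q)`,
`P` cuspidal on `GL_{m+1}(𝔸_K)` and `Q` cuspidal on `GL_m(𝔸_K)`, in translate form
(Jacquet–Piatetski-Shapiro–Shalika (1983), (2.7) at the finite places of `S₀`, by spread data;
Cogdell (2004), §4.1, `Ψ = ∏_v Ψ_v` for factorizable data): the `GL_{m+1} × GL_m` transcription of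
`LocalSingleDatum.stub_local_single_datum`. Given torus shifts `τ ∈ (𝔸_Kˣ)ᵐ` with `D' = diag τ` trivial at
`S₀ ∪ ∞` (`D = diag(τ, 1) = ι(D')`, `ι = glCorner`), pure tensors `S₁ ∈ π_f`, `S₁' ∈ σ_f` of levels
`K_f(𝔫P)`, `K_f(𝔫Q)` with `𝔫P 𝔫Q` supported on `S₀`, and `K_∞`-finite Gårding vectors `e`, `e'` of the
archimedean components `τP`, `τQ`, there are a level `𝔫` supported on `S₀`, HONEST continuous cusp forms
`Φ = S_η f`, `Φ' = S_{η'} f'` (right `K(𝔫)`-invariant, representing `f ∈ π`, `f' ∈ σ`) and `κ > 0` with,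
for every `s`,

  `∫_{B({v ∉ S₀}) × K} W_Φ(D ι ·) W̄_{Φ'}(D' ·) |det|^s δ⁻¹ = κ · Ψ^corner_∞(s; Φ_λ(D_f S₁), Φ_λ'(D'_f S₁'), e, e')`

(`archCornerPairIntegralCplx` against the image Haar measures). Everything deep is a LANDED helper of
the line; this file assembles:

* the finite set `S₁₀` (disjoint from `S₀`) off which `diag τ` is integral (`finite_setOf_exists_valued_ne_one`)
  and conjugation control `D_f⁻¹ K_f(𝔫P 𝔞) D_f ≤ K_f(𝔫P)`, `D'_f⁻¹ K_f(𝔫Q 𝔞') D'_f ≤ K_f(𝔫Q)` with `𝔞`, `𝔞'`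
  supported on `S₁₀` (`InitialVectorTranslateNeZero.exists_forall_conj_mem_finitePrincipalCongruenceLevel`);
* the initial pure tensors `f₁ = Ŝ₁ e ∈ P`, `f₁' = Ŝ₁' e' ∈ Q`; Harish-Chandra's level-fixing bump `β` for
  `f₁` at level `K_f(𝔫P)` on `GL_{m+1}` (`ArchLevelWeightFixingPair.stub_archLevelWeight_fixing_pair` with
  `P = Q`), the spread datum `f = E_L f₁` with `T₀ := S₀` and partner level `𝔫Q`, so that `T = S₀`
  (`SpreadPairDatumOfInitialDatum.stub_spreadPairDatum_of_initialDatum`), and the RESCALED bump `a⁻¹ β`, for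
  which `S_η f = f` exactly (`smoothedVector_archLevelWeight_smul`); the level-fixing bump `β'` for `f₁'`
  directly at level `K_f(𝔫)` on `GL_m`, `η' = β' ⊗ 𝟙_{K_f(𝔫)}`, `S_{η'} f₁' = f₁'`;
* HONESTY: `S_η f` and `S_{η'} f₁'` are cusp forms, right `K(𝔫)`-invariant, with classes `f`, `f₁'`
  (`exists_memLp_toLp_eq_isCuspFormGL_of_smoothedVector_eq`, i.e. `isAutomorphicForm_invQuot_smoothedForm_of_fixed`
  + `isCuspFormGL_invQuot_of_mem_cuspidalSubspace_holds`; `smoothedVector_ae_eq`), the `K_∞`-finiteness of the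
  spread vector `f = E_L Ŝ₁ e = T̂_L e` coming from the spread intertwiner (`exists_spreadIter_intertwiner`,
  `LocalSingleDatum.finiteDimensional_span_corestrictW`);
* the abstract properties of `W = W_{S_η f}` (on `GL_{m+1}`) and `W' = W_{S_{η'} f₁'}` (on `GL_m`)
  (`WhittakerCoeffSmoothedFormProps.stub_whittakerCoeff_smoothedForm_props`), the corner support collapse and
  product form on the unit box (`CornerUnitBoxProductForm.stub_corner_unitBox_productForm`), the archimedean
  values `W(D (ι h, 1)) = Φ_λ(D_f S₁)(τP(ι h) e)`, `W'(D' (h, 1)) = Φ_λ'(D'_f S₁')(τQ(h) e')`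
  (`TranslateArchValue.stub_translate_arch_value`, rank-generic), coset averaging on `GL_m`
  (`UnitBoxTranslateAvg.stub_unitBox_translate_avg`, test-function slot specialised to `1`) and
  `archCornerPairIntegralCplx_def`; `κ = r`.

All proofs complete; tree theorems only.

## References

* H. Jacquet, I. I. Piatetski-Shapiro, J. A. Shalika, *Rankin–Selberg convolutions*, Amer. J. Math.
  105 (1983), §2, (2.7) [JacquetPiatetskiShapiroShalika1983].
* J. W. Cogdell, *Analytic theory of L-functions for GL_n*, in *An Introduction to the Langlands
  Program* (2004), §1.2, §2.3, §4.1 [CogdellAnalyticTheory2004].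
-/

noncomputable section

-- `Summit.Langlands.Langlands.…` (summit = sub-problem name, D-0017 layout) trips `dupNamespace`
set_option linter.dupNamespace false

open scoped MatrixGroups Topology Pointwise ENNReal NNReal ComplexConjugate InnerProductSpace ContDiff
-- the place subtypes indexing `mixedSpace K` are `Fintype` classically (`NormedCommRing (mixedSpace K)`)
open scoped Classical Matrix.Norms.Operator
open NumberField IsDedekindDomain MeasureTheory Measure Matrix Set Filter WithZero
open NumberField.mixedEmbedding
open Literature.NumberTheory.Automorphic AdelicGroupData
open Literature.NumberTheory.GaloisRepresentations (ideleGroup HeckeCharacter)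
open Literature.MeasureTheory.Group
open Literature.RingTheory.SymmetricFunctions.SymmPoly
open ValuativeRel

-- the automorphic quotient carries the tree's Borel σ-algebra, not Mathlib's quotient σ-algebra
attribute [-instance] Quotient.instMeasurableSpace QuotientGroup.measurableSpace

-- the house local instances, exactly as in `RankinSelbergUnfoldingIdentity`
attribute [local instance] adelicBorel borelSpace_adelic locallyCompactSpace_adelic secondCountableTopology_gl_adelic
  glAdeleBorel borelSpace_glAdele borelSpace_ideleGroup secondCountableTopology_ideleGroup

-- Mathlib idiom: the commutator Lie ring on matrices, to mention `(archGroupGL n K).lie`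
attribute [local instance 100] LieRing.ofAssociativeRing

namespace Summit.Langlands.Langlands.Theorems.CornerLocalSingleDatum

/-! ### Small glue lemmas -/

/-- **Smoothing is linear in the archimedean factor of a product weight**:
`R((a α) ⊗ 𝟙_{U₀}) x = a R(α ⊗ 𝟙_{U₀}) x` (`(a α) ⊗ 𝟙_{U₀} = a (α ⊗ 𝟙_{U₀})` pointwise, and
`smoothedVector_smul_weight`). [folklore] -/
theorem smoothedVector_archLevelWeight_smul {n : ℕ} {K : Type} [Field K] [NumberField K]
    {μ : Measure (AdelicGroupData.gl n K).automorphicQuotient} [(AdelicGroupData.gl n K).IsAutomorphicMeasure μ]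
    (W : ContRepresentation.ClosedSubrep ((AdelicGroupData.gl n K).rightRegular μ))
    (U₀ : Subgroup (GL (Fin n) (FiniteAdeleRing (𝓞 K) K))) (a : ℝ) (α : GL (Fin n) (mixedSpace K) → ℝ)
    (x : W.toSubmodule) :
    smoothedVector W (archLevelWeight U₀ (a • α)) x = (a : ℂ) • smoothedVector W (archLevelWeight U₀ α) x := by
  have h : (archLevelWeight U₀ (a • α) : (AdelicGroupData.gl n K).Adelic → ℝ) = a • archLevelWeight U₀ α := by
    funext g
    simp only [archLevelWeight, Pi.smul_apply, smul_eq_mul, mul_assoc]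
  rw [h]
  exact smoothedVector_smul_weight W a _ x

/-- **Right `K(𝔫)`-invariance from right `(1, K_f(𝔫))`-invariance**: every element of `K(𝔫) ≤ K^max` is
`(1, u)` with `u ∈ K_f(𝔫)` (`eq_ofFinite_sndHom_of_mem_principalCongruenceLevel`). [folklore] -/
theorem isRightInvariant_of_map {n : ℕ} {K : Type} [Field K] [NumberField K] {𝔫 : Ideal (𝓞 K)}
    {φ : GL (Fin n) (AdeleRing (𝓞 K) K) → ℂ}
    (h : IsRightInvariantUnder ((finitePrincipalCongruenceLevel n K 𝔫).map (GLn.ofFiniteAdelic n K)) φ) :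
    ∀ u ∈ principalCongruenceLevel n K 𝔫, ∀ y : GL (Fin n) (AdeleRing (𝓞 K) K), φ (y * u) = φ y := by
  intro u hu y
  obtain ⟨hueq, hu'⟩ := eq_ofFinite_sndHom_of_mem_principalCongruenceLevel hu
  rw [hueq]
  exact h _ ⟨GLn.sndHom n K u, hu', rfl⟩ y

/-! ### The registered stub -/

set_option maxHeartbeats 1600000 in
/-- **STUB (W-CLSD) — ONE archimedean corner datum realised inside the translated corner box integral**
(the `GL_{m+1} × GL_m` analogue of `LocalSingleDatum.stub_local_single_datum`; Jacquet–Piatetski-Shapiro–Shalika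
(1983), (2.7) at the finite places of `S₀` by spread data; Cogdell (2004), §4.1, `Ψ = ∏_v Ψ_v` for factorizable
data). Given torus shifts `τ ∈ (𝔸_Kˣ)ᵐ` with `diag τ` trivial at `S₀ ∪ ∞`, pure tensors `S₁ ∈ π_f` (`π` cuspidal on
`GL_{m+1}`), `S₁' ∈ σ_f` (`σ` cuspidal on `GL_m`) of levels `K_f(𝔫P)`, `K_f(𝔫Q)` with `𝔫P 𝔫Q` supported on `S₀`, and
`K_∞`-finite Gårding vectors `e`, `e'` of the archimedean components `τP`, `τQ`, there are a level `𝔫` supported on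
`S₀`, HONEST continuous representatives `Φ`, `Φ'` (`IsCuspFormGL` of `invQuot`, right `K(𝔫)`-invariant) of vectors
`sv ∈ π`, `sv' ∈ σ` (the smoothed forms `S_η f`, `S_{η'} f'` of c3's M1 and their classes `R(η) f`, `R(η') f'`), and
`κ > 0` with, for every `s`,
`∫_{B({v ∉ S₀}) × K} W_Φ(diag(τ,1) ι ·) W̄_{Φ'}(diag τ ·) |det|^s δ⁻¹ = κ · Ψ^corner_∞(s; Φ_λ(diag(τ,1)_f S₁), Φ_λ'(diag(τ)_f S₁'), e, e')`
(`archCornerPairIntegralCplx` against the image Haar measures). Assembly as c3's M1 with the corner product form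
`stub_corner_unitBox_productForm`, `TranslateArchValue.stub_translate_arch_value` at corner points, the spread datum
for `π`, level-weight fixing for `e`, `e'` separately, coset averaging, and honesty by
`isAutomorphicForm_invQuot_smoothedForm_of_fixed` + `isCuspFormGL_invQuot_of_mem_cuspidalSubspace_holds`; the finite
set off which `diag τ` is integral is constructed inside (ideles are units almost everywhere).
[cite: CogdellAnalyticTheory2004, §4.1] [cite: JacquetPiatetskiShapiroShalika1983, §2 (2.7)] -/
theorem stub_corner_local_single_datum :
    ∀ {m : ℕ} {K : Type} [Field K] [NumberField K]
      {μ : Measure (gl (m + 1) K).automorphicQuotient} [(gl (m + 1) K).IsAutomorphicMeasure μ]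
      {μ' : Measure (gl m K).automorphicQuotient} [(gl m K).IsAutomorphicMeasure μ']
      [MeasurableSpace (AdeleRing (𝓞 K) K)] [BorelSpace (AdeleRing (𝓞 K) K)] (_ : 0 < m)
      (hcpt : isCompact_glFiniteIntegralLevel (m + 1) K) (hcpt' : isCompact_glFiniteIntegralLevel m K)
      (P : CuspidalAutomorphicRepGL (m + 1) K μ) (Q : CuspidalAutomorphicRepGL m K μ')
      (νA : Measure (Fin m → ideleGroup K)) [IsHaarMeasure νA]
      (νK : Measure ↥(maximalCompactAdelic m K)) [IsHaarMeasure νK]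
      (ν₀ : Measure ↥(adelicUnipotent (m + 1) K)) [IsHaarMeasure ν₀]
      (ν₀' : Measure ↥(adelicUnipotent m K)) [IsHaarMeasure ν₀']
      {E : Type} [NormedAddCommGroup E] [InnerProductSpace ℂ E] [CompleteSpace E]
      {τP : ContRepresentation ℂ (archGroupGL (m + 1) K).carrier E} (hτPc : τP.IsStronglyContinuous)
      {E' : Type} [NormedAddCommGroup E'] [InnerProductSpace ℂ E'] [CompleteSpace E']
      {τQ : ContRepresentation ℂ (archGroupGL m K).carrier E'} (hτQc : τQ.IsStronglyContinuous)
      (S₀ : Finset (HeightOneSpectrum (𝓞 K))) (τ : Fin m → ideleGroup K)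
      (_ : GLn.toMixed m K (glDiagonal m (AdeleRing (𝓞 K) K) τ) = 1)
      (_ : ∀ v ∈ S₀, localComponent v (glDiagonal m (AdeleRing (𝓞 K) K) τ) = 1)
      {𝔫P 𝔫Q : Ideal (𝓞 K)} (_ : 𝔫P ≠ 0) (_ : 𝔫Q ≠ 0)
      (_ : ∀ w ∉ S₀, ¬ w.asIdeal ∣ 𝔫P * 𝔫Q)
      (S₁ : multiplicityModule hcpt τP P.1)
      (_ : (S₁ : E →L[ℂ] (gl (m + 1) K).L2 μ) ∈ archIntertwinersLevel hcpt τP P.1 (finitePrincipalCongruenceLevel (m + 1) K 𝔫P))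
      (S₁' : multiplicityModule hcpt' τQ Q.1)
      (_ : (S₁' : E' →L[ℂ] (gl m K).L2 μ') ∈ archIntertwinersLevel hcpt' τQ Q.1 (finitePrincipalCongruenceLevel m K 𝔫Q))
      (e : archGardingSpace hcpt τP) (e' : archGardingSpace hcpt' τQ)
      (_ : FiniteDimensional ℂ (Submodule.span ℂ (Set.range
        fun κ : ↥(Kinf (m + 1) K) => τP (toArch hcpt κ.1) e.1)))
      (_ : FiniteDimensional ℂ (Submodule.span ℂ (Set.range
        fun κ : ↥(Kinf m K) => τQ (toArch hcpt' κ.1) e'.1)))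
      [MeasurableSpace (GL (Fin m) (mixedSpace K))] [BorelSpace (GL (Fin m) (mixedSpace K))],
    ∃ (𝔫 : Ideal (𝓞 K)) (_ : 𝔫 ≠ 0) (_ : ∀ w ∉ S₀, ¬ w.asIdeal ∣ 𝔫)
      (Φ : (gl (m + 1) K).automorphicQuotient → ℂ) (Φ' : (gl m K).automorphicQuotient → ℂ)
      (sv : P.1.toSubmodule) (sv' : Q.1.toSubmodule) (_ : Continuous Φ) (_ : Continuous Φ')
      (_ : ((sv : (gl (m + 1) K).L2 μ) : _ → ℂ) =ᵐ[μ] Φ)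
      (_ : ((sv' : (gl m K).L2 μ') : _ → ℂ) =ᵐ[μ'] Φ')
      (_ : IsCuspFormGL (m + 1) K hcpt (invQuot (gl (m + 1) K) Φ))
      (_ : IsCuspFormGL m K hcpt' (invQuot (gl m K) Φ'))
      (_ : ∀ u ∈ principalCongruenceLevel (m + 1) K 𝔫, ∀ y, invQuot (gl (m + 1) K) Φ (y * u :) = invQuot (gl (m + 1) K) Φ y)
      (_ : ∀ u ∈ principalCongruenceLevel m K 𝔫, ∀ y, invQuot (gl m K) Φ' (y * u :) = invQuot (gl m K) Φ' y)
      (κ : ℝ), 0 < κ ∧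
      ∀ s,
        ∫ p in unitBox {v | v ∉ (↑S₀ : Set _)} ×ˢ univ,
          torusPairIntegrandC m K
            (fun g => whittakerCoeff ν₀ (unipotentTateDomain (m + 1) K) (adeleAddChar K) (invQuot (gl (m + 1) K) Φ)
              (glDiagonal (m + 1) (AdeleRing (𝓞 K) K) (Fin.snoc τ 1) * glCorner (AdeleRing (𝓞 K) K) (Nat.le_succ m) g))
            (fun g => star (whittakerCoeff ν₀' (unipotentTateDomain m K) (adeleAddChar K) (invQuot (gl m K) Φ')
              (glDiagonal m (AdeleRing (𝓞 K) K) τ * g)))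
            (fun _ => 1) s p ∂(νA.prod νK) =
        (κ : ℂ) * archCornerPairIntegralCplx hcpt hcpt' τP hτPc τQ hτQc
          (transferMap (whittakerFunctional ν₀ (continuous_adeleAddChar K) (ContRepresentation.Equiv.refl P.1.toContRep)) hτPc
            (finComponentRep hcpt τP P.1 (GLn.sndHom (m + 1) K (glDiagonal (m + 1) (AdeleRing (𝓞 K) K) (Fin.snoc τ 1))) S₁))
          (transferMap (whittakerFunctional ν₀' (continuous_adeleAddChar K) (ContRepresentation.Equiv.refl Q.1.toContRep)) hτQc
            (finComponentRep hcpt' τQ Q.1 (GLn.sndHom m K (glDiagonal m (AdeleRing (𝓞 K) K) τ)) S₁')) e e'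
          ((νA.restrict (unitBox univ)).map (archTorusOfIdele m K)) (νK.map (kinfOfMaximalCompact m K)) s := by
  intro m K _ _ μ _ μ' _ _ _ hm
  obtain ⟨n, rfl⟩ : ∃ n, m = n + 1 := ⟨m - 1, (Nat.succ_pred_eq_of_pos hm).symm⟩
  intro hcpt hcpt' P Q νA _ νK _ ν₀ _ ν₀' _ E _ _ _ τP hτPc E' _ _ _ τQ hτQc S₀ τ hD'inf hD'S₀ 𝔫P 𝔫Q h𝔫P h𝔫Q hsupp
    S₁ hS₁ S₁' hS₁' e e' hefin he'fin _ _
  set D' : GL (Fin (n + 1)) (AdeleRing (𝓞 K) K) := glDiagonal (n + 1) (AdeleRing (𝓞 K) K) τ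
  set D : GL (Fin (n + 1 + 1)) (AdeleRing (𝓞 K) K) := glDiagonal (n + 1 + 1) (AdeleRing (𝓞 K) K) (Fin.snoc τ 1)
  have hne : 𝔫P * 𝔫Q ≠ 0 := mul_ne_zero h𝔫P h𝔫Q
  have hsupp' : ∀ w : HeightOneSpectrum (𝓞 K), w.asIdeal ∣ 𝔫P * 𝔫Q → w ∈ S₀ := fun w h => by_contra fun hw => hsupp w hw h
  /- the finite set `S₁₀` (disjoint from `S₀`) off which `D' = diag τ` is integral: ideles are units a.e. -/
  set S₁₀ : Finset (HeightOneSpectrum (𝓞 K)) := (finite_setOf_exists_valued_ne_one τ).toFinset \ S₀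
  have hS₀S₁₀ : ∀ v ∈ S₀, v ∉ S₁₀ := fun v hv h => (Finset.mem_sdiff.1 h).2 hv
  have hD'int : ∀ v ∉ S₁₀, localComponent v D' ∈ glInt (n + 1) (v.adicCompletion K) := by
    intro v hv
    by_cases hvS : v ∈ S₀
    · rw [hD'S₀ v hvS]; exact one_mem _
    · refine localComponent_glDiagonal_mem_glInt fun i => by_contra fun hi => hv ?_
      exact Finset.mem_sdiff.2 ⟨(Set.Finite.mem_toFinset _).2 ⟨i, hi⟩, hvS⟩
  /- `D = ι(D')`: the hypotheses on `D'` transported to `D` -/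
  have hDι : glCorner (AdeleRing (𝓞 K) K) (Nat.le_succ (n + 1)) D' = D := glCorner_glDiagonal_eq_glDiagonal_snoc τ
  have hDinf : GLn.toMixed (n + 1 + 1) K D = 1 := by rw [← hDι, GLn.toMixed_glCorner, hD'inf, map_one]
  have hDS₀ : ∀ v ∈ S₀, localComponent v D = 1 := fun v hv => by
    rw [← hDι, CornerPairTranslate.localComponent_glCorner, hD'S₀ v hv, map_one]
  have hDint : ∀ v ∉ S₁₀, localComponent v D ∈ glInt (n + 1 + 1) (v.adicCompletion K) := fun v hv => by
    rw [← hDι, CornerPairTranslate.localComponent_glCorner]; exact CornerPairTranslate.glCorner_mem_glInt _ (hD'int v hv)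
  /- (0) conjugation control `D_f⁻¹ K_f(𝔫P 𝔞P) D_f ≤ K_f(𝔫P)`, `D'_f⁻¹ K_f(𝔫Q 𝔞Q) D'_f ≤ K_f(𝔫Q)`, `𝔞P, 𝔞Q | S₁₀^∞` -/
  obtain ⟨kP, -, hconjP⟩ :=
    InitialVectorTranslateNeZero.exists_forall_conj_mem_finitePrincipalCongruenceLevel S₁₀ h𝔫P hDint
  obtain ⟨kQ, -, hconjQ⟩ :=
    InitialVectorTranslateNeZero.exists_forall_conj_mem_finitePrincipalCongruenceLevel S₁₀ h𝔫Q hD'int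
  have h𝔞P : (∏ v ∈ S₁₀, v.asIdeal ^ kP v : Ideal (𝓞 K)) ≠ 0 :=
    Finset.prod_ne_zero_iff.2 fun v _ => pow_ne_zero _ v.ne_bot
  have h𝔞Q : (∏ v ∈ S₁₀, v.asIdeal ^ kQ v : Ideal (𝓞 K)) ≠ 0 :=
    Finset.prod_ne_zero_iff.2 fun v _ => pow_ne_zero _ v.ne_bot
  /- (1) the initial pure tensors `f₁ = Ŝ₁ e ∈ π`, `f₁' = Ŝ₁' e' ∈ σ` and their levels -/
  set f₁ : P.1.toSubmodule := corestrictW (mem_archIntertwiners_of_mem_multiplicityModule S₁.2) (e : E)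
  set f₁' : Q.1.toSubmodule := corestrictW (mem_archIntertwiners_of_mem_multiplicityModule S₁'.2) (e' : E')
  have hf₁U : ∀ u ∈ finitePrincipalCongruenceLevel (n + 1 + 1) K 𝔫P,
      P.1.toContRep (GLn.ofFinite (n + 1 + 1) K u) f₁ = f₁ := fun u hu =>
    TranslateArchValue.toContRep_ofFinite_corestrictW_eq_self hS₁ _ hu (e : E)
  have hf₁'U : ∀ u ∈ finitePrincipalCongruenceLevel (n + 1) K 𝔫Q,
      Q.1.toContRep (GLn.ofFinite (n + 1) K u) f₁' = f₁' := fun u hu =>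
    TranslateArchValue.toContRep_ofFinite_corestrictW_eq_self hS₁' _ hu (e' : E')
  have hf₁fix : ∀ g ∈ principalCongruenceLevel (n + 1 + 1) K 𝔫P, P.1.toContRep g f₁ = f₁ :=
    LocalSingleDatum.toContRep_eq_self_of_forall_ofFinite P.1 hf₁U
  have hf₁'fix : ∀ g ∈ principalCongruenceLevel (n + 1) K 𝔫Q, Q.1.toContRep g f₁' = f₁' :=
    LocalSingleDatum.toContRep_eq_self_of_forall_ofFinite Q.1 hf₁'U
  /- (2) Harish-Chandra's level-fixing bump `β` for `f₁` at level `U₀ = K_f(𝔫P)` (on `GL_{m+1}`) -/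
  have hU₀o := isOpen_finitePrincipalCongruenceLevel (n + 1 + 1) K h𝔫P
  have hU₀c := isCompact_finitePrincipalCongruenceLevel (n + 1 + 1) K h𝔫P
  obtain ⟨β, hβc, hβs, hβsm, hfixP, -⟩ :=
    ArchLevelWeightFixingPair.stub_archLevelWeight_fixing_pair hcpt P P (Or.inr rfl) hU₀o hU₀c f₁ f₁
      (LocalSingleDatum.finiteDimensional_span_corestrictW _ (e : E) hefin)
      (LocalSingleDatum.finiteDimensional_span_corestrictW _ (e : E) hefin) hf₁U hf₁U
  /- (3) the spread datum from the initial datum `(𝔫P, f₁)` with `T₀ := S₀` and partner level `𝔫Q` -/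
  obtain ⟨T, hS₀T, hTsub, m₀, -, 𝔫, h𝔫, h𝔫Qdvd, -, hprimes, c, e_, ϖ, L, hL, hnd, hLT, hrad, f, hf, hffix, hβpart⟩ :=
    SpreadPairDatumOfInitialDatum.stub_spreadPairDatum_of_initialDatum P S₀ (𝔫' := 𝔫Q) (𝔫₁ := 𝔫P)
      h𝔫Q h𝔫P f₁ hf₁fix
  have hTS₀ : T ⊆ S₀ := fun v hv => (hTsub v hv).elim id fun h => hsupp' v h
  obtain rfl : S₀ = T := Finset.Subset.antisymm hS₀T hTS₀
  have hKo := isOpen_finitePrincipalCongruenceLevel (n + 1 + 1) K h𝔫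
  have hKc := isCompact_finitePrincipalCongruenceLevel (n + 1 + 1) K h𝔫
  have hKo' := isOpen_finitePrincipalCongruenceLevel (n + 1) K h𝔫
  have hKc' := isCompact_finitePrincipalCongruenceLevel (n + 1) K h𝔫
  -- the smoothing scalar `a` of the bump `β`: `S_{β ⊗ 𝟙_{K_f 𝔫}} f = a f`
  obtain ⟨_, a, rfl, -, ha, -, -, hsmooth₁, -⟩ := hβpart hβc hβs hβsm
  rw [hfixP, ← hf] at hsmooth₁
  -- the RESCALED bump `a⁻¹ β`: `η = (a⁻¹ β) ⊗ 𝟙_{K_f 𝔫}` fixes `f` exactly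
  have hβ₂c : Continuous (a⁻¹ • β) := hβc.const_smul a⁻¹
  have hβ₂s : HasCompactSupport (a⁻¹ • β) := hβs.mono (Function.support_const_smul_subset a⁻¹ β)
  have hβ₂sm : ∀ u : GL (Fin (n + 1 + 1)) (mixedSpace K), ContDiff ℝ ∞
      fun X : (archGroupGL (n + 1 + 1) K).lie.toSubmodule =>
        (a⁻¹ • β) (u * expGL (X : Matrix (Fin (n + 1 + 1)) (Fin (n + 1 + 1)) (mixedSpace K))) := fun u =>
    (hβsm u).const_smul a⁻¹
  obtain ⟨_, -, rfl, hη, -, hηleft, -, -, hblock⟩ := hβpart hβ₂c hβ₂s hβ₂sm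
  have hsmoothf : smoothedVector P.1 (archLevelWeight (finitePrincipalCongruenceLevel (n + 1 + 1) K 𝔫) (a⁻¹ • β)) f = f := by
    rw [smoothedVector_archLevelWeight_smul, hsmooth₁, smul_smul, Complex.ofReal_inv,
      inv_mul_cancel₀ (Complex.ofReal_ne_zero.2 ha.ne'), one_smul]
  have hsmoothf1 : smoothedVector P.1 (archLevelWeight (finitePrincipalCongruenceLevel (n + 1 + 1) K 𝔫) (a⁻¹ • β)) f =
      (1 : ℂ) • f := by rw [one_smul]; exact hsmoothf
  /- (4) the partner `f' := f₁'` and its level-fixing bump `β'` directly at level `K_f(𝔫)` (on `GL_m`) -/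
  have hK𝔫 : finitePrincipalCongruenceLevel (n + 1) K 𝔫 ≤ finitePrincipalCongruenceLevel (n + 1) K 𝔫Q :=
    fun u hu => mem_finitePrincipalCongruenceLevel_iff.2
      (principalCongruenceLevel_mono (n + 1) K h𝔫 (Ideal.le_of_dvd h𝔫Qdvd) (mem_finitePrincipalCongruenceLevel_iff.1 hu))
  have hf₁'K𝔫 : ∀ u ∈ finitePrincipalCongruenceLevel (n + 1) K 𝔫, Q.1.toContRep (GLn.ofFinite (n + 1) K u) f₁' = f₁' :=
    fun u hu => hf₁'U u (hK𝔫 hu)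
  obtain ⟨β', hβ'c, hβ's, hβ'sm, hfixQ, -⟩ :=
    ArchLevelWeightFixingPair.stub_archLevelWeight_fixing_pair hcpt' Q Q (Or.inr rfl) hKo' hKc' f₁' f₁'
      (LocalSingleDatum.finiteDimensional_span_corestrictW _ (e' : E') he'fin)
      (LocalSingleDatum.finiteDimensional_span_corestrictW _ (e' : E') he'fin) hf₁'K𝔫 hf₁'K𝔫
  have hη' : IsTestFunctionGL (n + 1) K (archLevelWeight (finitePrincipalCongruenceLevel (n + 1) K 𝔫) β') :=
    isTestFunctionGL_archLevelWeight hβ'c hβ's hβ'sm hKo' hKc'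
  have hη'left : ∀ u ∈ finitePrincipalCongruenceLevel (n + 1) K 𝔫, ∀ g : GL (Fin (n + 1)) (AdeleRing (𝓞 K) K),
      archLevelWeight (finitePrincipalCongruenceLevel (n + 1) K 𝔫) β' (GLn.ofFinite (n + 1) K u * g) =
        archLevelWeight (finitePrincipalCongruenceLevel (n + 1) K 𝔫) β' g := fun u hu g =>
    archLevelWeight_ofFinite_mul β' hu g
  have hsmoothf'1 : smoothedVector Q.1 (archLevelWeight (finitePrincipalCongruenceLevel (n + 1) K 𝔫) β') f₁' =
      (1 : ℂ) • f₁' := by rw [one_smul]; exact hfixQ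
  /- (5) HONESTY: `S_η f` and `S_{η'} f₁'` are cusp forms -/
  obtain ⟨TL, hTL, hTLa⟩ := exists_spreadIter_intertwiner h𝔫P hL hnd hS₁
  have hfTL : f = corestrictW hTL.1 (e : E) := by
    refine Subtype.ext (show ((f : P.1.toSubmodule) : (AdelicGroupData.gl (n + 1 + 1) K).L2 μ) = TL (e : E) from ?_)
    rw [hTLa, hf]
  have hffin : FiniteDimensional ℂ (Submodule.span ℂ (Set.range
      fun k : (AutomorphyDatum.gl (n + 1 + 1) K hcpt).arch.maximalCompact =>
        P.1.toContRep ((AutomorphyDatum.gl (n + 1 + 1) K hcpt).ofK k) f)) := by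
    rw [hfTL]; exact LocalSingleDatum.finiteDimensional_span_corestrictW hTL.1 (e : E) hefin
  have hUP : (finitePrincipalCongruenceLevel (n + 1 + 1) K 𝔫).map (GLn.ofFiniteAdelic (n + 1 + 1) K) ∈
      (AutomorphyDatum.gl (n + 1 + 1) K hcpt).finiteLevels := ⟨_, hKo, hKc, rfl⟩
  have hUQ : (finitePrincipalCongruenceLevel (n + 1) K 𝔫).map (GLn.ofFiniteAdelic (n + 1) K) ∈
      (AutomorphyDatum.gl (n + 1) K hcpt').finiteLevels := ⟨_, hKo', hKc', rfl⟩
  obtain ⟨-, -, hcuspP, hRP⟩ := exists_memLp_toLp_eq_isCuspFormGL_of_smoothedVector_eq hcpt P hUP hη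
    (by rintro _ ⟨u, hu, rfl⟩ g; exact hηleft u hu g) hsmoothf hffin
  obtain ⟨-, -, hcuspQ, hRQ⟩ := exists_memLp_toLp_eq_isCuspFormGL_of_smoothedVector_eq hcpt' Q hUQ hη'
    (by rintro _ ⟨u, hu, rfl⟩ g; exact hη'left u hu g) hfixQ
    (LocalSingleDatum.finiteDimensional_span_corestrictW _ (e' : E') he'fin)
  -- the classes: `[S_η f] = R(η) f = f`, `[S_{η'} f₁'] = f₁'`
  have haeP := smoothedVector_ae_eq P.1 hη.continuous hη.hasCompactSupport f
  have haeQ := smoothedVector_ae_eq Q.1 hη'.continuous hη'.hasCompactSupport f₁'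
  rw [hsmoothf] at haeP; rw [hfixQ] at haeQ
  /- (6) the abstract properties of `W = W_{S_η f}` (on `GL_{m+1}`) and `W' = W_{S_{η'} f₁'}` (on `GL_m`) -/
  obtain ⟨hWN, hWZ, hWK, -, hWc⟩ :=
    WhittakerCoeffSmoothedFormProps.stub_whittakerCoeff_smoothedForm_props P ν₀ (𝔫 := 𝔫) (𝔫' := 𝔫) h𝔫 hη f hffix
  obtain ⟨hW'N, -, hW'K, hW'loc, hW'c⟩ :=
    WhittakerCoeffSmoothedFormProps.stub_whittakerCoeff_smoothedForm_props Q ν₀' (𝔫 := 𝔫) (𝔫' := 𝔫Q) h𝔫Q hη'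
      f₁' hf₁'fix
  set W : GL (Fin (n + 1 + 1)) (AdeleRing (𝓞 K) K) → ℂ := whittakerCoeff ν₀ (unipotentTateDomain (n + 1 + 1) K) (adeleAddChar K)
    (invQuot (AdelicGroupData.gl (n + 1 + 1) K) (smoothedForm (archLevelWeight (finitePrincipalCongruenceLevel (n + 1 + 1) K 𝔫) (a⁻¹ • β))
      ((f : P.1.toSubmodule) : (AdelicGroupData.gl (n + 1 + 1) K).L2 μ)))
  set W' : GL (Fin (n + 1)) (AdeleRing (𝓞 K) K) → ℂ := whittakerCoeff ν₀' (unipotentTateDomain (n + 1) K) (adeleAddChar K)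
    (invQuot (AdelicGroupData.gl (n + 1) K) (smoothedForm (archLevelWeight (finitePrincipalCongruenceLevel (n + 1) K 𝔫) β')
      ((f₁' : Q.1.toSubmodule) : (AdelicGroupData.gl (n + 1) K).L2 μ')))
  /- (7) support collapse and product form of the corner pair on the unit box -/
  obtain ⟨𝔪, h𝔪, F, hFinv, hF01, hF1, hIF⟩ :=
    CornerUnitBoxProductForm.stub_corner_unitBox_productForm W W' hWN hW'N hWZ h𝔫 hWK
      (fun u hu g => hW'K u (hK𝔫 hu) g) hprimes τ hD'S₀
      (fun v hv => by
        obtain ⟨tv, M, c₀, hsp, hψ, hM1, hcnt, hmono, hgap, -⟩ := hblock ν₀ inferInstance v hv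
        refine ⟨tv, M, c₀, hsp, hψ, hM1, hmono, hgap, fun κ hκ g =>
          hW'loc v κ (valuedCongruenceSubgroup_mono (Fin (n + 1)) ?_ hκ) g⟩
        rw [idealRadius_eq_exp_neg_natCast v h𝔫Q, exp_le_exp, neg_le_neg_iff]; exact hcnt) νA νK
  /- (8) the archimedean values of `W` at `D (ι h, 1)` and of `W'` at `D' (h, 1)` -/
  have hrad₁ : ∀ v ∈ L, exp (-e_ v) ≤ idealRadius K v 𝔫P := fun v hv =>
    (hrad v hv).trans (idealRadius_mono K v hne Ideal.mul_le_right)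
  have hDL : ∀ v ∈ L, localComponent v D = 1 := fun v hv => hDS₀ v ((hLT v).1 hv)
  have h𝔞PL : ∀ v ∈ L, ¬ v.asIdeal ∣ ∏ w ∈ S₁₀, w.asIdeal ^ kP w := fun v hv hdvd =>
    hS₀S₁₀ v ((hLT v).1 hv) (LocalSingleDatum.mem_of_dvd_prod_pow kP hdvd)
  have hAval : ∀ h : GL (Fin (n + 1 + 1)) (mixedSpace K), W (D * GLn.ofInfinite (n + 1 + 1) K h) = (1 : ℂ) *
      transferMap (whittakerFunctional ν₀ (continuous_adeleAddChar K) (ContRepresentation.Equiv.refl P.1.toContRep)) hτPc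
        (finComponentRep hcpt τP P.1 (GLn.sndHom (n + 1 + 1) K D) S₁)
        ⟨τP (toArch hcpt h) (e : E), apply_mem_archGardingSpace hτPc _ e.2⟩ := fun h =>
    TranslateArchValue.stub_translate_arch_value hcpt P hτPc ν₀ h𝔫P S₁ hS₁ e hL hnd hrad₁ D hDL hDinf h𝔞P h𝔞PL hconjP
      hη f hf hsmoothf1 h
  have hBval : ∀ h : GL (Fin (n + 1)) (mixedSpace K), W' (D' * GLn.ofInfinite (n + 1) K h) = (1 : ℂ) *
      transferMap (whittakerFunctional ν₀' (continuous_adeleAddChar K) (ContRepresentation.Equiv.refl Q.1.toContRep)) hτQc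
        (finComponentRep hcpt' τQ Q.1 (GLn.sndHom (n + 1) K D') S₁')
        ⟨τQ (toArch hcpt' h) (e' : E'), apply_mem_archGardingSpace hτQc _ e'.2⟩ := fun h =>
    TranslateArchValue.stub_translate_arch_value hcpt' Q hτQc ν₀' h𝔫Q S₁' hS₁' e' (c := c) (e := e_) (ϖ := ϖ)
      (L := []) (fun v hv => by simp at hv) List.nodup_nil (fun v hv => by simp at hv) D' (fun v hv => by simp at hv)
      hD'inf h𝔞Q (fun v hv => by simp at hv) hconjQ hη' f₁' rfl hsmoothf'1 h
  /- (9) coset averaging on `GL_m` -/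
  set A : GL (Fin (n + 1)) (mixedSpace K) → ℂ := fun x =>
    W (D * GLn.ofInfinite (n + 1 + 1) K (glCorner (mixedSpace K) (Nat.le_succ (n + 1)) x)) with hAdef
  set B : GL (Fin (n + 1)) (mixedSpace K) → ℂ := fun x => conj (W' (D' * GLn.ofInfinite (n + 1) K x)) with hBdef
  have hA : Continuous A := hWc.comp (continuous_const.mul
    ((GLn.continuous_ofInfinite (n + 1 + 1) K).comp (continuous_glCorner (R := mixedSpace K) (Nat.le_succ (n + 1)))))
  have hB : Continuous B :=
    Complex.continuous_conj.comp (hW'c.comp (continuous_const.mul (GLn.continuous_ofInfinite (n + 1) K)))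
  set I : ℂ → (Fin (n + 1) → ideleGroup K) × ↥(maximalCompactAdelic (n + 1) K) → ℂ := fun s =>
    torusPairIntegrandC (n + 1) K (fun g => W (D * glCorner (AdeleRing (𝓞 K) K) (Nat.le_succ (n + 1)) g))
      (fun g => star W' (D' * g)) (fun _ => (1 : ℝ)) s
  have hprod : ∀ (s : ℂ) (p : (Fin (n + 1) → ideleGroup K) × ↥(maximalCompactAdelic (n + 1) K)),
      p.1 ∈ unitBox (n := n + 1) (K := K) (Set.univ : Set (HeightOneSpectrum (𝓞 K))) →
      I s p = F (GLn.sndHom (n + 1) K (torusPoint (n + 1) K p)) *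
        (A (GLn.toMixed (n + 1) K (torusPoint (n + 1) K p)) * B (GLn.toMixed (n + 1) K (torusPoint (n + 1) K p)) *
          archTorusWeightC (n + 1) K s (archTorusOfIdele (n + 1) K p.1)) := fun s p hp =>
    (hIF s).2 p hp
  -- the corner integrand with a test-function slot `Φ_∞` (specialised to `Φ_∞ = 1` below)
  set I' := fun (Φinf : (Fin (n + 1) → InfiniteAdeleRing K) → ℝ) (s : ℂ)
      (p : (Fin (n + 1) → ideleGroup K) × ↥(maximalCompactAdelic (n + 1) K)) =>
    I s p * ((Φinf (archLastRow (n + 1) K (GLn.toMixed (n + 1) K (torusPoint (n + 1) K p))) : ℝ) : ℂ) with hI'def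
  obtain ⟨r, hr, havg⟩ :=
    UnitBoxTranslateAvg.stub_unitBox_translate_avg hcpt' νA νK h𝔪 F hFinv 1 hF01 hF1 A B hA hB I'
      (fun Φinf s p hp => by rw [hI'def]; dsimp only; rw [hprod s p hp]; ring)
  /- (10) the datum -/
  refine ⟨𝔫, h𝔫, fun w hw h => hw (hprimes w h), _, _, f, f₁',
    continuous_smoothedForm hη.continuous hη.hasCompactSupport _,
    continuous_smoothedForm hη'.continuous hη'.hasCompactSupport _, haeP, haeQ, hcuspP, hcuspQ,
    isRightInvariant_of_map hRP, isRightInvariant_of_map hRQ, r, hr, fun s => ?_⟩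
  have h2 : ∫ p in unitBox (Set.univ : Set (HeightOneSpectrum (𝓞 K))) ×ˢ Set.univ, I s p ∂(νA.prod νK) =
      ∫ p in unitBox (Set.univ : Set (HeightOneSpectrum (𝓞 K))) ×ˢ Set.univ, I' (fun _ => (1 : ℝ)) s p ∂(νA.prod νK) := by
    refine integral_congr_ae (Eventually.of_forall fun p => ?_)
    rw [hI'def]; dsimp only; rw [Complex.ofReal_one, mul_one]
  refine ((hIF s).1.trans h2).trans ((havg (fun _ => (1 : ℝ)) continuous_const s).trans ?_)
  rw [archCornerPairIntegralCplx_def, ← integral_const_mul, ← integral_const_mul]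
  refine integral_congr_ae (Eventually.of_forall fun z => ?_)
  rw [hAdef, hBdef]
  dsimp only
  rw [hAval, hBval]
  simp only [one_mul, mul_one, Complex.ofReal_one]
  rfl

end Summit.Langlands.Langlands.Theorems.CornerLocalSingleDatum

end
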